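import Mathlib
import Summits.Ventures.PercRepro2.SharpHalves
import Summits.Ventures.PercRepro2.TypeRB

/-!
# The `L`-half of (HCOV) at the centring `1` is a THEOREM (blind cell PercRepro2, night-1 g35)

The `L`-half of the crux functional is `Γ_L = 2 P(Q) Cov_Q(1_{bL}, Ξ_γ)` with
`Ξ_c = 1_{a₃∈H}(1_{o∈U} − c) − 1_{oH}` (`SharpHalves.lean`), and `Cov_Q(1_{bL}, Ξ_c)` is increasing in
the centring `c` (slope `−Cov_Q(1_{bL}, 1_{a₃∈H}) ≥ 0`, `SharpHalves.TbL_mul_Q_le`).  At the top of the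
family, `c = 1`, `Ξ_1 = −1_{oH} − 1_{a₃∈H, o∉U}` and the half is a positive-association statement that
the cell's exploration machinery proves:

* **`endpoint_one`** (`Cov_Q(1_{bL}, 1_{oH} + 1_{a₃∈H, o∉U}) ≤ 0`, cleared):
  `P(Q) · [P(Q, bL, oH) + P(T, bL, o∉U)] ≤ P(Q, bL) · [P(Q, oH) + P(T, o∉U)]`,
  `T = Q ∩ {a₃ ∈ C(a₂)}` (`TEvent ends a₁ a₂ a₃`), `{o ∉ U} = Dtilde ends a₁ a₂ o`.

Proof: explore `H = C(a₂)` under `Q = {a₂ ↮ a₁}` (`prob_clusterIn_inter_avoid_eq_expect`): every mass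
is `E[1_𝓤(H) · g_𝓥(H) · 1_Q]` with `g_𝓥(W) = P(C(a₁) ∈ 𝓥 in G − W)` (`delClusterProb`); in `G − W`
Harris gives `P(a₁ ↔ b, a₁ ↮ o) ≤ ρ_b (1 − ρ_o)` (`rho_inter_le`), so the left side is at most
`P(Q) · E[ρ_b(H) F(H) 1_Q]` with the functional `F(W) = 1_{o∈W} + 1_{a₃∈W, o∉W}(1 − ρ_o(W))`
(`Fend`, increasing in `W`, `0 ≤ F ≤ 1`), while the right side is `E[ρ_b 1_Q] · E[F 1_Q]`; BHK 1.3
(`bhk_induced`) for the increasing functionals `1 − ρ_b` and `F` of `C(a₂)` under the avoidance of `a₁`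
closes: `E[(1 − ρ_b) 1_Q] E[F 1_Q] ≤ E[(1 − ρ_b) F 1_Q] P(Q)`.

Consequences (night-1 g35): the centring family interpolates between this theorem (`c = 1`) and the
half itself (`c = γ = D_o/D`, census-true under the kit adversary, 0 exact negatives in 25,600 graphs /
102,400 climbs); the least admissible centring lies in `[c₀, γ]` and `c₀ = P(oL|T) + P(oH|R)` is NOT
admissible (`SharpHalvesRefutation`); the whole content of the `L`-half is the descent from `1` to `γ`.
-/

namespace Summit.Ventures.PercRepro2

namespace HalfEndpoint

open UnionCluster CovForm SideBridge

open scoped Classical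

variable {V : Type*} {E : Type*} [Fintype E] [DecidableEq E] [Fintype V] [DecidableEq V]
  {R : Type*} [Field R] [LinearOrder R] [IsStrictOrderedRing R]

section Functionals

variable (p : E → R) (ends : E → Sym2 V)

/-- `ρ_v(W) = P(v ∈ C(a₁) in G − W)`. -/
noncomputable def rho (a₁ v : V) (W : Set V) : R :=
  delClusterProb p ends a₁ {W' : Set V | v ∈ W'} W

/-- The endpoint functional of the cluster `W` of `a₂`:
`F(W) = 1_{o ∈ W} + 1_{a₃ ∈ W, o ∉ W} · (1 − ρ_o(W))`. -/
noncomputable def Fend (o a₁ a₃ : V) (W : Set V) : R :=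
  ({W' : Set V | o ∈ W'} : Set (Set V)).indicator 1 W +
    ({W' : Set V | a₃ ∈ W' ∧ o ∉ W'} : Set (Set V)).indicator 1 W * (1 - rho p ends a₁ o W)

omit [Fintype V] [DecidableEq V] in
/-- `ρ_v` is antitone in `W`. -/
lemma rho_anti (hp : IsProbVec p) (a₁ v : V) : Antitone (rho p ends a₁ v) :=
  delClusterProb_anti p hp ends a₁ (isUpperSet_mem_setOf v)

omit [Fintype V] [DecidableEq V] in
/-- `0 ≤ ρ_v`. -/
lemma rho_nonneg (hp : IsProbVec p) (a₁ v : V) (W : Set V) : 0 ≤ rho p ends a₁ v W :=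
  delClusterProb_nonneg p hp ends a₁ _ W

omit [Fintype V] [DecidableEq V] in
/-- `ρ_v ≤ 1`. -/
lemma rho_le_one (hp : IsProbVec p) (a₁ v : V) (W : Set V) : rho p ends a₁ v W ≤ 1 :=
  delClusterProb_le_one p hp ends a₁ _ W

omit [Fintype V] [DecidableEq V] in
/-- **Harris in `G − W`**: `P(b ∈ C(a₁), o ∉ C(a₁)) ≤ ρ_b (1 − ρ_o)`. -/
lemma rho_inter_le (hp : IsProbVec p) (a₁ b o : V) (W : Set V) :
    delClusterProb p ends a₁ {W' : Set V | b ∈ W' ∧ o ∉ W'} W ≤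
      rho p ends a₁ b W * (1 - rho p ends a₁ o W) := by
  unfold rho delClusterProb
  have e : {ω : Config E | cluster ends (delConfig ends W ω) a₁ ∈ {W' : Set V | b ∈ W' ∧ o ∉ W'}} =
      {ω : Config E | cluster ends (delConfig ends W ω) a₁ ∈ {W' : Set V | o ∈ W'}}ᶜ ∩
        {ω : Config E | cluster ends (delConfig ends W ω) a₁ ∈ {W' : Set V | b ∈ W'}} := by
    ext ω
    simp only [Set.mem_setOf_eq, Set.mem_inter_iff, Set.mem_compl_iff]
    tauto
  rw [e]
  have h := prob_inter_le_prob_mul_prob_of_isLowerSet hp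
    (TypeRB.isUpperSet_delCluster ends W a₁ (isUpperSet_mem_setOf o)).compl
    (TypeRB.isUpperSet_delCluster ends W a₁ (isUpperSet_mem_setOf b))
  rw [prob_compl] at h
  linarith [h]

omit [Fintype V] [DecidableEq V] [LinearOrder R] [IsStrictOrderedRing R] in
/-- The two indicators of `F` at a set containing `o`. -/
lemma Fend_of_mem (o a₁ a₃ : V) {W : Set V} (ho : o ∈ W) : Fend p ends o a₁ a₃ W = 1 := by
  unfold Fend
  rw [Set.indicator_of_mem (show W ∈ {W' : Set V | o ∈ W'} from ho),
    Set.indicator_of_notMem (show W ∉ {W' : Set V | a₃ ∈ W' ∧ o ∉ W'} from fun h => h.2 ho)]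
  simp

omit [Fintype V] [DecidableEq V] [LinearOrder R] [IsStrictOrderedRing R] in
/-- `F` at a set not containing `o`. -/
lemma Fend_of_notMem (o a₁ a₃ : V) {W : Set V} (ho : o ∉ W) :
    Fend p ends o a₁ a₃ W =
      ({W' : Set V | a₃ ∈ W'} : Set (Set V)).indicator 1 W * (1 - rho p ends a₁ o W) := by
  unfold Fend
  rw [Set.indicator_of_notMem (show W ∉ {W' : Set V | o ∈ W'} from ho)]
  by_cases ha : a₃ ∈ W
  · rw [Set.indicator_of_mem (show W ∈ {W' : Set V | a₃ ∈ W' ∧ o ∉ W'} from ⟨ha, ho⟩),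
      Set.indicator_of_mem (show W ∈ {W' : Set V | a₃ ∈ W'} from ha)]
    simp
  · rw [Set.indicator_of_notMem (show W ∉ {W' : Set V | a₃ ∈ W' ∧ o ∉ W'} from fun h => ha h.1),
      Set.indicator_of_notMem (show W ∉ {W' : Set V | a₃ ∈ W'} from ha)]
    simp

omit [Fintype V] [DecidableEq V] in
/-- `0 ≤ F`. -/
lemma Fend_nonneg (hp : IsProbVec p) (o a₁ a₃ : V) (W : Set V) : 0 ≤ Fend p ends o a₁ a₃ W := by
  by_cases ho : o ∈ W
  · rw [Fend_of_mem p ends o a₁ a₃ ho]; exact zero_le_one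
  · rw [Fend_of_notMem p ends o a₁ a₃ ho]
    exact mul_nonneg (Set.indicator_apply_nonneg fun _ => zero_le_one)
      (by linarith [rho_le_one p ends hp a₁ o W])

omit [Fintype V] [DecidableEq V] in
/-- **`F` is increasing in `W`.** -/
lemma Fend_mono (hp : IsProbVec p) (o a₁ a₃ : V) : Monotone (Fend p ends o a₁ a₃) := by
  intro W W' h
  by_cases ho' : o ∈ W'
  · rw [Fend_of_mem p ends o a₁ a₃ ho']
    by_cases ho : o ∈ W
    · rw [Fend_of_mem p ends o a₁ a₃ ho]
    · rw [Fend_of_notMem p ends o a₁ a₃ ho]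
      have h0 := rho_nonneg p ends hp a₁ o W
      have hI : ({W' : Set V | a₃ ∈ W'} : Set (Set V)).indicator (1 : Set V → R) W ≤ 1 := by
        by_cases ha : a₃ ∈ W
        · rw [Set.indicator_of_mem (show W ∈ {W' : Set V | a₃ ∈ W'} from ha)]; simp
        · rw [Set.indicator_of_notMem (show W ∉ {W' : Set V | a₃ ∈ W'} from ha)]; simp
      have hI0 : 0 ≤ ({W' : Set V | a₃ ∈ W'} : Set (Set V)).indicator (1 : Set V → R) W :=
        Set.indicator_apply_nonneg fun _ => zero_le_one
      nlinarith [hI, hI0, h0]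
  · have ho : o ∉ W := fun hW => ho' (h hW)
    rw [Fend_of_notMem p ends o a₁ a₃ ho, Fend_of_notMem p ends o a₁ a₃ ho']
    have hρ : rho p ends a₁ o W' ≤ rho p ends a₁ o W := rho_anti p ends hp a₁ o h
    have h1 := rho_le_one p ends hp a₁ o W
    by_cases ha : a₃ ∈ W
    · rw [Set.indicator_of_mem (show W ∈ {W' : Set V | a₃ ∈ W'} from ha),
        Set.indicator_of_mem (show W' ∈ {W' : Set V | a₃ ∈ W'} from h ha)]
      simp only [Pi.one_apply, one_mul]
      linarith
    · rw [Set.indicator_of_notMem (show W ∉ {W' : Set V | a₃ ∈ W'} from ha)]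
      simp only [zero_mul]
      exact mul_nonneg (Set.indicator_apply_nonneg fun _ => zero_le_one)
        (by linarith [rho_le_one p ends hp a₁ o W'])

end Functionals

section Masses

variable (p : E → R) (ends : E → Sym2 V) (o a₁ a₂ a₃ b : V)

omit [Fintype E] [DecidableEq E] [Fintype V] [DecidableEq V] [LinearOrder R]
  [IsStrictOrderedRing R] in
/-- `{oH} ∩ Q` through the clusters. -/
lemma e_oH : clusterInEvent ends a₂ {W : Set V | o ∈ W} ∩ clusterInEvent ends a₁ Set.univ ∩
    avoidAll ends a₂ {a₁} = avoidAll ends a₂ {a₁} ∩ connEvent ends a₂ o := by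
  ext ω
  simp only [Set.mem_inter_iff, mem_clusterInEvent, Set.mem_setOf_eq, mem_cluster, Set.mem_univ,
    mem_connEvent, and_true]
  tauto

omit [Fintype E] [DecidableEq E] [Fintype V] [DecidableEq V] [LinearOrder R]
  [IsStrictOrderedRing R] in
/-- `T ∩ {o ∉ U}` through the clusters. -/
lemma e_ToN : clusterInEvent ends a₂ {W : Set V | a₃ ∈ W ∧ o ∉ W} ∩
    clusterInEvent ends a₁ {W : Set V | o ∉ W} ∩ avoidAll ends a₂ {a₁} =
      TEvent ends a₁ a₂ a₃ ∩ Dtilde ends a₁ a₂ o := by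
  ext ω
  simp only [Set.mem_inter_iff, mem_clusterInEvent, Set.mem_setOf_eq, mem_cluster, mem_avoidAll,
    Finset.mem_singleton, forall_eq, TEvent, Dtilde, inU, Set.mem_compl_iff, Set.mem_union,
    mem_connEvent]
  have h1 : Conn ends ω o a₁ ↔ Conn ends ω a₁ o := ⟨conn_symm, conn_symm⟩
  have h2 : Conn ends ω o a₂ ↔ Conn ends ω a₂ o := ⟨conn_symm, conn_symm⟩
  tauto

omit [Fintype E] [DecidableEq E] [Fintype V] [DecidableEq V] [LinearOrder R]
  [IsStrictOrderedRing R] in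
/-- `{bL} ∩ Q` through the clusters. -/
lemma e_bL : clusterInEvent ends a₂ Set.univ ∩ clusterInEvent ends a₁ {W : Set V | b ∈ W} ∩
    avoidAll ends a₂ {a₁} = avoidAll ends a₂ {a₁} ∩ connEvent ends a₁ b := by
  ext ω
  simp only [Set.mem_inter_iff, mem_clusterInEvent, Set.mem_setOf_eq, mem_cluster, Set.mem_univ,
    mem_connEvent, true_and]
  tauto

omit [Fintype E] [DecidableEq E] [Fintype V] [DecidableEq V] [LinearOrder R]
  [IsStrictOrderedRing R] in
/-- `{oH, bL} ∩ Q` through the clusters. -/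
lemma e_oHbL : clusterInEvent ends a₂ {W : Set V | o ∈ W} ∩
    clusterInEvent ends a₁ {W : Set V | b ∈ W} ∩ avoidAll ends a₂ {a₁} =
      avoidAll ends a₂ {a₁} ∩ (connEvent ends a₂ o ∩ connEvent ends a₁ b) := by
  ext ω
  simp only [Set.mem_inter_iff, mem_clusterInEvent, Set.mem_setOf_eq, mem_cluster, mem_connEvent]
  tauto

omit [Fintype E] [DecidableEq E] [Fintype V] [DecidableEq V] [LinearOrder R]
  [IsStrictOrderedRing R] in
/-- `T ∩ {bL, o ∉ U}` through the clusters. -/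
lemma e_TbLoN : clusterInEvent ends a₂ {W : Set V | a₃ ∈ W ∧ o ∉ W} ∩
    clusterInEvent ends a₁ {W : Set V | b ∈ W ∧ o ∉ W} ∩ avoidAll ends a₂ {a₁} =
      TEvent ends a₁ a₂ a₃ ∩ (connEvent ends a₁ b ∩ Dtilde ends a₁ a₂ o) := by
  ext ω
  simp only [Set.mem_inter_iff, mem_clusterInEvent, Set.mem_setOf_eq, mem_cluster, mem_avoidAll,
    Finset.mem_singleton, forall_eq, TEvent, Dtilde, inU, Set.mem_compl_iff, Set.mem_union,
    mem_connEvent]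
  have h1 : Conn ends ω o a₁ ↔ Conn ends ω a₁ o := ⟨conn_symm, conn_symm⟩
  have h2 : Conn ends ω o a₂ ↔ Conn ends ω a₂ o := ⟨conn_symm, conn_symm⟩
  tauto

end Masses

section Endpoint

variable (p : E → R) (ends : E → Sym2 V) (o a₁ a₂ a₃ b : V)

omit [Fintype V] [DecidableEq V] [LinearOrder R] [IsStrictOrderedRing R] in
/-- `g_univ = 1`. -/
lemma delClusterProb_univ' (t : V) (W : Set V) :
    delClusterProb p ends t (Set.univ : Set (Set V)) W = 1 := by
  unfold delClusterProb
  simp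

/-- **THE ENDPOINT THEOREM** (`Cov_Q(1_{bL}, 1_{oH} + 1_{a₃∈H, o∉U}) ≤ 0`, cleared):
`P(Q) [P(Q, bL, oH) + P(T, bL, o∉U)] ≤ P(Q, bL) [P(Q, oH) + P(T, o∉U)]`. -/
theorem endpoint_one (hp : IsProbVec p) :
    prob p (avoidAll ends a₂ {a₁}) *
        (prob p (avoidAll ends a₂ {a₁} ∩ (connEvent ends a₂ o ∩ connEvent ends a₁ b)) +
          prob p (TEvent ends a₁ a₂ a₃ ∩ (connEvent ends a₁ b ∩ Dtilde ends a₁ a₂ o))) ≤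
      prob p (avoidAll ends a₂ {a₁} ∩ connEvent ends a₁ b) *
        (prob p (avoidAll ends a₂ {a₁} ∩ connEvent ends a₂ o) +
          prob p (TEvent ends a₁ a₂ a₃ ∩ Dtilde ends a₁ a₂ o)) := by
  have h1 : a₁ ∈ ({a₁} : Finset V) := Finset.mem_singleton_self a₁
  -- the five masses through the exploration of `C(a₂)`
  have m1 := prob_clusterIn_inter_avoid_eq_expect p ends a₂ a₁ h1 {W : Set V | o ∈ W} Set.univ
  have m2 := prob_clusterIn_inter_avoid_eq_expect p ends a₂ a₁ h1 {W : Set V | a₃ ∈ W ∧ o ∉ W}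
    {W : Set V | o ∉ W}
  have m3 := prob_clusterIn_inter_avoid_eq_expect p ends a₂ a₁ h1 Set.univ {W : Set V | b ∈ W}
  have m4 := prob_clusterIn_inter_avoid_eq_expect p ends a₂ a₁ h1 {W : Set V | o ∈ W}
    {W : Set V | b ∈ W}
  have m5 := prob_clusterIn_inter_avoid_eq_expect p ends a₂ a₁ h1 {W : Set V | a₃ ∈ W ∧ o ∉ W}
    {W : Set V | b ∈ W ∧ o ∉ W}
  rw [e_oH] at m1
  rw [e_ToN] at m2
  rw [e_bL] at m3
  rw [e_oHbL] at m4
  rw [e_TbLoN] at m5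
  simp only [delClusterProb_univ', Set.indicator_univ, Pi.one_apply, one_mul, mul_one] at m1 m3
  -- `g_{o∉·} = 1 − ρ_o`
  have hc : ∀ W : Set V, delClusterProb p ends a₁ {W' : Set V | o ∉ W'} W =
      1 - rho p ends a₁ o W := by
    intro W
    unfold rho delClusterProb
    have e : {ω : Config E | cluster ends (delConfig ends W ω) a₁ ∈ {W' : Set V | o ∉ W'}} =
        {ω : Config E | cluster ends (delConfig ends W ω) a₁ ∈ {W' : Set V | o ∈ W'}}ᶜ := by
      ext ω
      simp only [Set.mem_setOf_eq, Set.mem_compl_iff]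
    rw [e, prob_compl]
  simp only [hc] at m2
  -- Harris in `G − H` bounds the fifth mass
  have m5' : prob p (TEvent ends a₁ a₂ a₃ ∩ (connEvent ends a₁ b ∩ Dtilde ends a₁ a₂ o)) ≤
      expect p (fun ω => ({W : Set V | a₃ ∈ W ∧ o ∉ W} : Set (Set V)).indicator 1 (cluster ends ω a₂) *
        (rho p ends a₁ b (cluster ends ω a₂) * (1 - rho p ends a₁ o (cluster ends ω a₂))) *
        (avoidAll ends a₂ {a₁}).indicator 1 ω) := by
    rw [m5]
    refine expect_mono hp fun ω => ?_
    have hI : 0 ≤ ({W : Set V | a₃ ∈ W ∧ o ∉ W} : Set (Set V)).indicator (1 : Set V → R)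
        (cluster ends ω a₂) := Set.indicator_apply_nonneg fun _ => zero_le_one
    have hQ0 : 0 ≤ (avoidAll ends a₂ {a₁}).indicator (1 : Config E → R) ω :=
      Set.indicator_apply_nonneg fun _ => zero_le_one
    exact mul_le_mul_of_nonneg_right
      (mul_le_mul_of_nonneg_left (rho_inter_le p ends hp a₁ b o _) hI) hQ0
  -- assemble `E[ρ_b F 1_Q]`, `E[F 1_Q]`, `E[ρ_b 1_Q]`
  have hL : prob p (avoidAll ends a₂ {a₁} ∩ (connEvent ends a₂ o ∩ connEvent ends a₁ b)) +
      prob p (TEvent ends a₁ a₂ a₃ ∩ (connEvent ends a₁ b ∩ Dtilde ends a₁ a₂ o)) ≤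
      expect p (fun ω => rho p ends a₁ b (cluster ends ω a₂) * Fend p ends o a₁ a₃ (cluster ends ω a₂) *
        (avoidAll ends a₂ {a₁}).indicator 1 ω) := by
    refine (add_le_add (le_of_eq m4) m5').trans (le_of_eq ?_)
    rw [← expect_add]
    exact congrArg (expect p) (funext fun ω => by
      simp only [Pi.add_apply, Fend, rho]
      ring)
  have hR : prob p (avoidAll ends a₂ {a₁} ∩ connEvent ends a₂ o) +
      prob p (TEvent ends a₁ a₂ a₃ ∩ Dtilde ends a₁ a₂ o) =
      expect p (fun ω => Fend p ends o a₁ a₃ (cluster ends ω a₂) *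
        (avoidAll ends a₂ {a₁}).indicator 1 ω) := by
    rw [m1, m2, ← expect_add]
    exact congrArg (expect p) (funext fun ω => by
      simp only [Pi.add_apply, Fend]
      ring)
  -- BHK 1.3 for the increasing functionals `1 − ρ_b` and `F` of `C(a₂)` under the avoidance of `a₁`
  have hF₁ : Monotone (fun W => 1 - rho p ends a₁ b W) := fun W W' h => by
    simp only; linarith [rho_anti p ends hp a₁ b h]
  have hF₁0 : ∀ W, 0 ≤ 1 - rho p ends a₁ b W := fun W => by
    linarith [rho_le_one p ends hp a₁ b W]
  have hF₂ : Monotone (Fend p ends o a₁ a₃) := Fend_mono p ends hp o a₁ a₃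
  have hF₂0 : ∀ W, 0 ≤ Fend p ends o a₁ a₃ W := Fend_nonneg p ends hp o a₁ a₃
  have key := bhk_induced p hp ends a₂ hF₁ hF₂ hF₁0 hF₂0 Finset.univ {a₁} {a₁}
    (Finset.subset_univ _) (Finset.subset_univ _)
  simp only [Finset.inter_self, Finset.union_self, REvent_univ] at key
  have e : ∀ G : Set V → R, clusterObs ends Finset.univ a₂ G * (avoidAll ends a₂ {a₁}).indicator 1 =
      fun ω => G (cluster ends ω a₂) * (avoidAll ends a₂ {a₁}).indicator 1 ω := by
    intro G
    funext ω
    simp only [Pi.mul_apply, clusterObs_apply, clusterIn_univ]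
  rw [e, e, e] at key
  simp only [Pi.mul_apply] at key
  have eQ : prob p (avoidAll ends a₂ {a₁}) =
      expect p fun ω => (avoidAll ends a₂ {a₁}).indicator 1 ω := prob_eq_expect_indicator p _
  have k1 : expect p (fun ω => (1 - rho p ends a₁ b (cluster ends ω a₂)) *
      (avoidAll ends a₂ {a₁}).indicator 1 ω) =
      prob p (avoidAll ends a₂ {a₁}) - expect p (fun ω => rho p ends a₁ b (cluster ends ω a₂) *
        (avoidAll ends a₂ {a₁}).indicator 1 ω) := by
    rw [eQ, ← expect_sub]
    exact congrArg (expect p) (funext fun ω => by simp only [Pi.sub_apply]; ring)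
  have k12 : expect p (fun ω => (1 - rho p ends a₁ b (cluster ends ω a₂)) *
      Fend p ends o a₁ a₃ (cluster ends ω a₂) * (avoidAll ends a₂ {a₁}).indicator 1 ω) =
      expect p (fun ω => Fend p ends o a₁ a₃ (cluster ends ω a₂) *
        (avoidAll ends a₂ {a₁}).indicator 1 ω) -
      expect p (fun ω => rho p ends a₁ b (cluster ends ω a₂) *
        Fend p ends o a₁ a₃ (cluster ends ω a₂) * (avoidAll ends a₂ {a₁}).indicator 1 ω) := by
    rw [← expect_sub]
    exact congrArg (expect p) (funext fun ω => by simp only [Pi.sub_apply]; ring)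
  rw [k1, k12] at key
  -- `key : (P(Q) − A) B ≤ (B − C) P(Q)`, i.e. `P(Q) C ≤ A B`
  have m3' : prob p (avoidAll ends a₂ {a₁} ∩ connEvent ends a₁ b) =
      expect p (fun ω => rho p ends a₁ b (cluster ends ω a₂) *
        (avoidAll ends a₂ {a₁}).indicator 1 ω) := m3
  rw [m3', hR]
  have hPQ : 0 ≤ prob p (avoidAll ends a₂ {a₁}) := prob_nonneg hp _
  calc prob p (avoidAll ends a₂ {a₁}) *
        (prob p (avoidAll ends a₂ {a₁} ∩ (connEvent ends a₂ o ∩ connEvent ends a₁ b)) +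
          prob p (TEvent ends a₁ a₂ a₃ ∩ (connEvent ends a₁ b ∩ Dtilde ends a₁ a₂ o)))
      ≤ prob p (avoidAll ends a₂ {a₁}) *
          expect p (fun ω => rho p ends a₁ b (cluster ends ω a₂) *
            Fend p ends o a₁ a₃ (cluster ends ω a₂) * (avoidAll ends a₂ {a₁}).indicator 1 ω) :=
        mul_le_mul_of_nonneg_left hL hPQ
    _ ≤ _ := by nlinarith [key]

end Endpoint


end HalfEndpoint

end Summit.Ventures.PercRepro2
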